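/-
Copyright (c) 2026 the pub-hodgecm-mathlib formalisation cell (harness21).  Prover seat hodgecm-mathlib-R90-CS-p03 (g4), Track B ∕ R90-TF, h413 = `stmt-HodgeConjecture-24833`,
R90-TF section S8 «ContSpec-n½» (S8 dealer R90-CS-plan (g3) S8-R245 (a) «A ROAD FOR hW1», rulings J-S8-W1′ (S8-R249: three named letters + hW1_wild) and S8-R252 «CS-p03 (g4)
hW1_wild =»; LH4-p10 (g9) l.11160 «phrase (hstab) over generators GIVEN WITH a regular datum»): the `K_∞`-side of the hW1 road in PROJECTOR-FREE form (hISO) and in the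
REGULAR ∕ WILD split (hKreg) + (hKwild), over ★ p865018's Peter–Weyl separation.
-/
import Summits.HodgeConjecture.HodgeConjecture.Theorems.R90S8ResGMidBlockLeTauOfIsotypicProjectionU3   -- ★ p865018 (this seat): `hW1_of_tauLevel_atoms_le`, `mem_closedSubrep_of_forall_kTypeProj_mem` (Peter–Weyl separation in `L²`), `map_charProj_of_commute`;
                                                                                                      --   brings ★ D1–D3, ★ τ-DEFS, ★ `rightRegular_apply_mem_resGMidAtom` (K2E1-p11), ★ `charProj_mem_isotypicComponent`, ★ `compactSpace_arch_inf_unitaryOne`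
import Summits.HodgeConjecture.HodgeConjecture.Theorems.K2E1MaximalLevelHeckePureTensorBridgeCMTwo     -- ★ (K2E1 lineage): `adelicVal_archToAdelic_inclusion_mem_standardMaximalCompactGL` (`ι_∞(K_∞) ⊆ K_∞·GL_N(𝒪̂)`, every rank `N`, every form)
import HarnessLib

/-!
# S8 (R)′ ∕ (M) ∕ (V♭) letter `hW1`, SECOND FILE — `R90S8ResGMidBlockLeTauOfRegularU3`: the `K_∞`-side of the hW1 road in PROJECTOR-FREE, MEASURE-FREE form (hISO) «the τ-isotypic
# vectors of the τ-LEVEL atoms lie in the τ-block», and in the REGULAR ∕ WILD split (hKreg) + (hKwild) that LH4-p10 (g9)'s `admissible_rightAverage` pays by name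

Track B ∕ R90-TF, crux h413 = `stmt-HodgeConjecture-24833`, route of record `HCCMUnconditional`; cell `hodgecm-mathlib`, R90-TF section S8 «ContSpec-n½», letter `hW1 : resGMidBlock ξ μω ≤
resGMidBlockτ ξ μω` of (R)′ :337 ∕ (M) :299 ∕ (V♭) :406.  THEOREMS ONLY (no `def`, no `instance`, no `notation`, no named-fact hypothesis, no `sorry`; default heartbeats); lane
`--supports stmt-HodgeConjecture-24833 --as helper` (count-neutral).  CLOSES NO SOCKET: it refines ★ p865018's named letter (hstab) twice — (i) into a letter WITHOUT Haar measure,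
measurable structure or projector in its bytes, (ii) into a datum-level letter over REGULAR data (the shape ★ `admissible_rightAverage` + its class bridge conclude) plus ONE wild letter.

THE MATHEMATICS ([BrockerTomDieck1985] III (5.5), Thm. (5.10); [MoeglinWaldspurger1995] I.2.17, II.1, IV.1.9–IV.1.11, V.3.13; [BorelJacquet1979] §4.1, §4.6).  `K_∞ = U(J₃)(L⁺⊗ℝ) ∩ U(1⊗1)`
(compact ★) acts on `L²` through `ρ = R ∘ ι_∞`; `ι_∞(K_∞) ⊆ K_max` (★ `adelicVal_archToAdelic_inclusion_mem_standardMaximalCompactGL`) preserves the Borel height (★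
`borelHeight_mul_of_mem_comap_standardMaximalCompactGL`) and commutes with every τ-level `ι_f(U₀)` (★ `commute_archToAdelic_finAdelicToAdelic`), so ★ `rightRegular_apply_mem_resGMidAtom`
makes every τ-LEVEL atom `A_{U₀} := resGMidAtom ξ μω (ι_f U₀) 1` a CLOSED `K_∞`-STABLE subspace (§1); hence the `K_∞`-type cut `P_τ v = dim τ • ∫ conj χ_τ(k) • ρ k v dk` of `v ∈ A_{U₀}` stays
in `A_{U₀}` (a closed subspace contains the Bochner integrals of its members, §1) and lies in the τ-isotypic component (★ `charProj_mem_isotypicComponent` [BT85 III (5.10)]): `P_τ v ∈ A_{U₀} ⊓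
Iso_τ`.  With ★ p865018's Peter–Weyl separation this gives (§2) **`hW1_of_isotypic (hFIN) (hISO)`**, where (hISO) «`A_{U₀} ⊓ Iso_τ ≤ resGMidBlockτ` for every τ-level `U₀` and every
irreducible unitary finite-dimensional `τ`» carries NO measure: the Haar probability measure of `K_∞` is built inside the proof (Mathlib `haarMeasure ⊤` on the Borel σ-algebra).  §3 is
the REGULAR ∕ WILD split of ruling J-S8-W1′ (hW1 = hW1_reg + hW1_wild): a REGULAR datum is ★ D1's `(φ, Ec, Sp, Fp)` with ESTATE T's two regularity exports on the slit half-plane —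
`hE4 : ∀ z ∈ {1<Re}∖Sp, Continuous (Ec z)` and the joint local bound `hEbd` — in ★ `admissible_rightAverage`'s bytes; (hKreg) «the `K_∞`-type cut of the class of a REGULAR τ-level datum is
a τ-admissible generator» is what ★ `admissible_rightAverage` (function level) + LH4-p10's FILE 2 (class bridge + `IsArchFinite`) conclude BY NAME; (hKwild) = hW1_wild «every τ-level atom is
the closed span of the classes of its REGULAR data» is the honest residue (L, unowned: residues of non-smooth data with merely pointwise continuation, unprinted); HEAD **`hW1_of_regular
(hFIN) (hKwild) (hKreg)`**.
* §1 `rightRegular_archToAdelic_inclusion_apply_mem_resGMidAtom_tauLevel` (τ-level atoms are `K_∞`-stable), `integral_mem_of_forall_mem` (closed subspaces contain Bochner integrals),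
  **`charProj_mem_resGMidAtom_tauLevel`** (`P_τ A_{U₀} ⊆ A_{U₀}`), `charProj_mem_resGMidAtom_tauLevel_inf_isotypicComponent`.
* §2 **`resGMidAtom_tauLevel_le_resGMidBlockτ_of_isotypic (hISO)`**, **`hW1_of_isotypic (hFIN) (hISO) : resGMidBlock L μ ξ μω ≤ resGMidBlockτ L μ ξ μω`** (MEASURE-FREE LETTERS).
* §3 **`genRegular_tauLevel_subset_resGMidBlockτ (hKreg)`**, **`hW1_of_regular (hFIN) (hKwild) (hKreg) : resGMidBlock L μ ξ μω ≤ resGMidBlockτ L μ ξ μω`**.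
HONEST LABEL: HC_CM is proved only modulo the 7 printed citations (2 remaining named inputs: hLiu418 = `stmt-HodgeConjecture-24832`, h413 = `stmt-HodgeConjecture-24833`) until
rung 0 closes; REL ≠ ★ ≠ BUILT; this file PAYS NO SOCKET: hW1 = ★ ∘ {(hFIN) (K2E1-p14 (g5) typing, its own letter (hAVG) M∕L), (hKreg) (LH4-p10 (g9) ★ FILE 1 + FILE 2 in flight, M),
(hKwild) = hW1_wild (L, UNOWNED, unprinted)}; count-neutral.

## References
* [BrockerTomDieck1985] T. Bröcker, T. tom Dieck, *Representations of Compact Lie Groups*, GTM 98 (1985), III (5.5), Thm. (5.10).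
* [MoeglinWaldspurger1995] C. Mœglin, J.-L. Waldspurger, *Spectral Decomposition and Eisenstein Series* (1995), I.2.17, II.1, IV.1.9–IV.1.11, V.3.13.
* [BorelJacquet1979] A. Borel, H. Jacquet, *Automorphic forms and automorphic representations*, Corvallis PSPM 33.1 (1979), §4.1, §4.6.
* [DeitmarEchterhoff2014] A. Deitmar, S. Echterhoff, *Principles of Harmonic Analysis* (2nd ed., 2014), Prop. 7.3.3.
* [Rogawski1990] J. D. Rogawski, *Automorphic Representations of Unitary Groups in Three Variables* (1990), §13.9 p. 229 (ii).
-/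

set_option autoImplicit false
set_option linter.dupNamespace false  -- the mandated namespace `…HodgeConjecture.HodgeConjecture.R90.S8` (LEAD #1 L1) repeats the summit's segment

noncomputable section

open MeasureTheory Measure Set Filter Topology NumberField NumberField.mixedEmbedding ContRepresentation
open Literature.NumberTheory Literature.NumberTheory.Automorphic Literature.NumberTheory.Automorphic.UnitaryGroup Literature.NumberTheory.GaloisRepresentations AdelicGroupData
open Literature.NumberTheory.Automorphic.Arthur2013.Leaves.TECR Literature.NumberTheory.Rogawski1990
open Literature.RepresentationTheory.CompactGroups
open Summit.HodgeConjecture.HodgeConjecture.Cruxes.H413.K2E1BorelEisensteinU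
open Summit.HodgeConjecture.HodgeConjecture.Cruxes.H413.K2E1ChiSectionSpaceU3PairDefs
open Summit.HodgeConjecture.HodgeConjecture.Cruxes.H413.K2E1MaximalLevelHeckePureTensorBridgeCMTwo (adelicVal_archToAdelic_inclusion_mem_standardMaximalCompactGL)
open scoped ENNReal NNReal InnerProductSpace ComplexConjugate

namespace Summit.HodgeConjecture.HodgeConjecture.R90.S8

/-! ## §1 The τ-level atoms are closed `K_∞`-stable subspaces; their `K_∞`-type cuts stay inside and are isotypic -/

section Stable

variable (L : Type) [Field L] [NumberField L] [IsCMField L]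
  (μ : Measure (quasiSplit (↥(maximalRealSubfield L)) L (IsCMField.complexConj L) 3).automorphicQuotient)
  [(quasiSplit (↥(maximalRealSubfield L)) L (IsCMField.complexConj L) 3).IsAutomorphicMeasure μ]
  (ξ : OneDimAutRepH L) (μω : HeckeCharacter L)

/-- **THE τ-LEVEL ATOMS ARE `K_∞`-STABLE**: for `a ∈ K_∞ = U(J₃)(L⁺⊗ℝ) ∩ U(1⊗1)` and a τ-level `U₀`, `R(ι_∞ a)` maps `resGMidAtom ξ μω (ι_f U₀) 1` into itself — ★ `rightRegular_apply_mem_resGMidAtom` with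
height invariance (★ `adelicVal_archToAdelic_inclusion_mem_standardMaximalCompactGL` + ★ `borelHeight_mul_of_mem_comap_standardMaximalCompactGL`) and commutation with the level (★
`commute_archToAdelic_finAdelicToAdelic`, the level is `ι_f(U₀)`). [cite: MoeglinWaldspurger1995, II.1.5, V.3.13] [cite: BorelJacquet1979, §4.1, §4.6] -/
theorem rightRegular_archToAdelic_inclusion_apply_mem_resGMidAtom_tauLevel
    (U₀ : Subgroup ↥(finAdelic (↥(maximalRealSubfield L)) L (IsCMField.complexConj L) 3 ((StdForm.antidiagonal 3).over L)))
    (a : ↥(UnitaryGroup.arch (↥(maximalRealSubfield L)) L (IsCMField.complexConj L) 3 ((StdForm.antidiagonal 3).over L) ⊓ unitaryGroupOfForm (conjMixed (↥(maximalRealSubfield L)) L (IsCMField.complexConj L)) 1))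
    {v : (quasiSplit (↥(maximalRealSubfield L)) L (IsCMField.complexConj L) 3).L2 μ} (hv : v ∈ resGMidAtom L μ ξ μω (tauLevel L U₀) 1) :
    ((quasiSplit (↥(maximalRealSubfield L)) L (IsCMField.complexConj L) 3).rightRegular μ)
        (archToAdelic (↥(maximalRealSubfield L)) L (IsCMField.complexConj L) 3 ((StdForm.antidiagonal 3).over L)
          (Subgroup.inclusion (inf_le_left : (UnitaryGroup.arch (↥(maximalRealSubfield L)) L (IsCMField.complexConj L) 3 ((StdForm.antidiagonal 3).over L) ⊓ unitaryGroupOfForm (conjMixed (↥(maximalRealSubfield L)) L (IsCMField.complexConj L)) 1) ≤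
            UnitaryGroup.arch (↥(maximalRealSubfield L)) L (IsCMField.complexConj L) 3 ((StdForm.antidiagonal 3).over L)) a)) v ∈ resGMidAtom L μ ξ μω (tauLevel L U₀) 1 := by
  refine rightRegular_apply_mem_resGMidAtom L μ ξ μω (tauLevel L U₀) 1 (fun g => ?_) (fun k' hk' => ?_) hv
  · exact borelHeight_mul_of_mem_comap_standardMaximalCompactGL (Subgroup.mem_comap.2 (adelicVal_archToAdelic_inclusion_mem_standardMaximalCompactGL a)) g
  · obtain ⟨b, -, rfl⟩ := (mem_tauLevel_iff L U₀ k').1 hk'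
    exact (commute_archToAdelic_finAdelicToAdelic _ _ _ _ _ _ b).eq.symm

/-- **A CLOSED subspace of a Hilbert space contains the Bochner integrals of its members** (orthogonal projection ∘ integral = integral ∘ orthogonal projection, Mathlib
`ContinuousLinearMap.integral_comp_comm`; a non-integrable integrand integrates to `0`). [folklore] -/
theorem integral_mem_of_forall_mem {V : Type*} [NormedAddCommGroup V] [InnerProductSpace ℂ V] [CompleteSpace V] {X : Type*} [MeasurableSpace X] (ν : Measure X)
    {A : Submodule ℂ V} (hA : IsClosed (A : Set V)) {f : X → V} (hf : ∀ x, f x ∈ A) : ∫ x, f x ∂ν ∈ A := by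
  haveI : CompleteSpace A := hA.completeSpace_coe
  by_cases hfi : Integrable f ν
  · have h : A.starProjection (∫ x, f x ∂ν) = ∫ x, f x ∂ν := by
      rw [← A.starProjection.integral_comp_comm hfi]
      exact integral_congr_ae (Filter.Eventually.of_forall fun x => Submodule.starProjection_eq_self_iff.2 (hf x))
    exact Submodule.starProjection_eq_self_iff.1 h
  · rw [integral_undef hfi]
    exact A.zero_mem

variable
  [MeasurableSpace ↥(UnitaryGroup.arch (↥(maximalRealSubfield L)) L (IsCMField.complexConj L) 3 ((StdForm.antidiagonal 3).over L) ⊓ unitaryGroupOfForm (conjMixed (↥(maximalRealSubfield L)) L (IsCMField.complexConj L)) 1)]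
  [BorelSpace ↥(UnitaryGroup.arch (↥(maximalRealSubfield L)) L (IsCMField.complexConj L) 3 ((StdForm.antidiagonal 3).over L) ⊓ unitaryGroupOfForm (conjMixed (↥(maximalRealSubfield L)) L (IsCMField.complexConj L)) 1)]
  (μK : Measure ↥(UnitaryGroup.arch (↥(maximalRealSubfield L)) L (IsCMField.complexConj L) 3 ((StdForm.antidiagonal 3).over L) ⊓ unitaryGroupOfForm (conjMixed (↥(maximalRealSubfield L)) L (IsCMField.complexConj L)) 1))
  [IsProbabilityMeasure μK] [μK.IsMulLeftInvariant]

omit [BorelSpace ↥(UnitaryGroup.arch (↥(maximalRealSubfield L)) L (IsCMField.complexConj L) 3 ((StdForm.antidiagonal 3).over L) ⊓ unitaryGroupOfForm (conjMixed (↥(maximalRealSubfield L)) L (IsCMField.complexConj L)) 1)]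
  [IsProbabilityMeasure μK] [μK.IsMulLeftInvariant] in
/-- **THE `K_∞`-TYPE CUT OF A τ-LEVEL ATOM VECTOR STAYS IN THE ATOM**: `P_τ v = dim τ • ∫ conj χ_τ(k) • R(ι_∞ k) v dμ_K ∈ resGMidAtom ξ μω (ι_f U₀) 1` for `v` there (the atom is closed and
`K_∞`-stable). [cite: BrockerTomDieck1985, III Thm (5.10)] [cite: MoeglinWaldspurger1995, V.3.13] -/
theorem charProj_mem_resGMidAtom_tauLevel
    (U₀ : Subgroup ↥(finAdelic (↥(maximalRealSubfield L)) L (IsCMField.complexConj L) 3 ((StdForm.antidiagonal 3).over L)))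
    {E : Type*} [NormedAddCommGroup E] [InnerProductSpace ℂ E] [FiniteDimensional ℂ E]
    (τ : ContRepresentation ℂ ↥(UnitaryGroup.arch (↥(maximalRealSubfield L)) L (IsCMField.complexConj L) 3 ((StdForm.antidiagonal 3).over L) ⊓ unitaryGroupOfForm (conjMixed (↥(maximalRealSubfield L)) L (IsCMField.complexConj L)) 1) E)
    {v : (quasiSplit (↥(maximalRealSubfield L)) L (IsCMField.complexConj L) 3).L2 μ} (hv : v ∈ resGMidAtom L μ ξ μω (tauLevel L U₀) 1) :
    Schur.charProj μK τ ((((quasiSplit (↥(maximalRealSubfield L)) L (IsCMField.complexConj L) 3).rightRegular μ).restrict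
        ((archToAdelic (↥(maximalRealSubfield L)) L (IsCMField.complexConj L) 3 ((StdForm.antidiagonal 3).over L)).comp
          (Subgroup.inclusion (inf_le_left : (UnitaryGroup.arch (↥(maximalRealSubfield L)) L (IsCMField.complexConj L) 3 ((StdForm.antidiagonal 3).over L) ⊓ unitaryGroupOfForm (conjMixed (↥(maximalRealSubfield L)) L (IsCMField.complexConj L)) 1) ≤
            UnitaryGroup.arch (↥(maximalRealSubfield L)) L (IsCMField.complexConj L) 3 ((StdForm.antidiagonal 3).over L)))))) v ∈ resGMidAtom L μ ξ μω (tauLevel L U₀) 1 := by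
  rw [Schur.charProj_def]
  refine Submodule.smul_mem _ _ (integral_mem_of_forall_mem μK (isClosed_resGMidAtom L μ ξ μω (tauLevel L U₀) 1) fun k => Submodule.smul_mem _ _ ?_)
  rw [ContRepresentation.restrict_apply, MonoidHom.coe_comp, Function.comp_apply]
  exact rightRegular_archToAdelic_inclusion_apply_mem_resGMidAtom_tauLevel L μ ξ μω U₀ k hv

/-- **… AND IT IS τ-ISOTYPIC**: `P_τ v ∈ resGMidAtom ξ μω (ι_f U₀) 1 ⊓ Iso_τ(R ∘ ι_∞|_{K_∞})` (★ `charProj_mem_isotypicComponent`; `R` unitary ★ `isUnitary_rightRegular`, strongly continuous ★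
`isStronglyContinuous_rightRegular_holds`). [cite: BrockerTomDieck1985, III Thm (5.10)] -/
theorem charProj_mem_resGMidAtom_tauLevel_inf_isotypicComponent
    (U₀ : Subgroup ↥(finAdelic (↥(maximalRealSubfield L)) L (IsCMField.complexConj L) 3 ((StdForm.antidiagonal 3).over L)))
    {E : Type*} [NormedAddCommGroup E] [InnerProductSpace ℂ E] [FiniteDimensional ℂ E]
    (τ : ContRepresentation ℂ ↥(UnitaryGroup.arch (↥(maximalRealSubfield L)) L (IsCMField.complexConj L) 3 ((StdForm.antidiagonal 3).over L) ⊓ unitaryGroupOfForm (conjMixed (↥(maximalRealSubfield L)) L (IsCMField.complexConj L)) 1) E)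
    (hτc : Continuous (τ : ↥(UnitaryGroup.arch (↥(maximalRealSubfield L)) L (IsCMField.complexConj L) 3 ((StdForm.antidiagonal 3).over L) ⊓ unitaryGroupOfForm (conjMixed (↥(maximalRealSubfield L)) L (IsCMField.complexConj L)) 1) → E →L[ℂ] E))
    [τ.toRepresentation.IsIrreducible]
    (hτu : ∀ (g : ↥(UnitaryGroup.arch (↥(maximalRealSubfield L)) L (IsCMField.complexConj L) 3 ((StdForm.antidiagonal 3).over L) ⊓ unitaryGroupOfForm (conjMixed (↥(maximalRealSubfield L)) L (IsCMField.complexConj L)) 1)) (x y : E), ⟪τ g x, τ g y⟫_ℂ = ⟪x, y⟫_ℂ)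
    {v : (quasiSplit (↥(maximalRealSubfield L)) L (IsCMField.complexConj L) 3).L2 μ} (hv : v ∈ resGMidAtom L μ ξ μω (tauLevel L U₀) 1) :
    Schur.charProj μK τ ((((quasiSplit (↥(maximalRealSubfield L)) L (IsCMField.complexConj L) 3).rightRegular μ).restrict
        ((archToAdelic (↥(maximalRealSubfield L)) L (IsCMField.complexConj L) 3 ((StdForm.antidiagonal 3).over L)).comp
          (Subgroup.inclusion (inf_le_left : (UnitaryGroup.arch (↥(maximalRealSubfield L)) L (IsCMField.complexConj L) 3 ((StdForm.antidiagonal 3).over L) ⊓ unitaryGroupOfForm (conjMixed (↥(maximalRealSubfield L)) L (IsCMField.complexConj L)) 1) ≤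
            UnitaryGroup.arch (↥(maximalRealSubfield L)) L (IsCMField.complexConj L) 3 ((StdForm.antidiagonal 3).over L)))))) v ∈
      resGMidAtom L μ ξ μω (tauLevel L U₀) 1 ⊓
        ((((quasiSplit (↥(maximalRealSubfield L)) L (IsCMField.complexConj L) 3).rightRegular μ).restrict
          ((archToAdelic (↥(maximalRealSubfield L)) L (IsCMField.complexConj L) 3 ((StdForm.antidiagonal 3).over L)).comp
            (Subgroup.inclusion (inf_le_left : (UnitaryGroup.arch (↥(maximalRealSubfield L)) L (IsCMField.complexConj L) 3 ((StdForm.antidiagonal 3).over L) ⊓ unitaryGroupOfForm (conjMixed (↥(maximalRealSubfield L)) L (IsCMField.complexConj L)) 1) ≤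
              UnitaryGroup.arch (↥(maximalRealSubfield L)) L (IsCMField.complexConj L) 3 ((StdForm.antidiagonal 3).over L))))).isotypicComponent τ).toSubmodule := by
  haveI : CompactSpace ↥(UnitaryGroup.arch (↥(maximalRealSubfield L)) L (IsCMField.complexConj L) 3 ((StdForm.antidiagonal 3).over L) ⊓ unitaryGroupOfForm (conjMixed (↥(maximalRealSubfield L)) L (IsCMField.complexConj L)) 1) :=
    compactSpace_arch_inf_unitaryOne L 3 ((StdForm.antidiagonal 3).over L)
  have hU := (quasiSplit (↥(maximalRealSubfield L)) L (IsCMField.complexConj L) 3).isUnitary_rightRegular μ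
  have hS := (quasiSplit (↥(maximalRealSubfield L)) L (IsCMField.complexConj L) 3).isStronglyContinuous_rightRegular_holds μ
  have hκc := continuous_inclusion_arch_inf_unitaryOne L 3 ((StdForm.antidiagonal 3).over L)
  refine Submodule.mem_inf.2 ⟨charProj_mem_resGMidAtom_tauLevel L μ ξ μω μK U₀ τ hv, ?_⟩
  exact charProj_mem_isotypicComponent μK
    (π := (((quasiSplit (↥(maximalRealSubfield L)) L (IsCMField.complexConj L) 3).rightRegular μ).restrict
        ((archToAdelic (↥(maximalRealSubfield L)) L (IsCMField.complexConj L) 3 ((StdForm.antidiagonal 3).over L)).comp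
          (Subgroup.inclusion (inf_le_left : (UnitaryGroup.arch (↥(maximalRealSubfield L)) L (IsCMField.complexConj L) 3 ((StdForm.antidiagonal 3).over L) ⊓ unitaryGroupOfForm (conjMixed (↥(maximalRealSubfield L)) L (IsCMField.complexConj L)) 1) ≤
            UnitaryGroup.arch (↥(maximalRealSubfield L)) L (IsCMField.complexConj L) 3 ((StdForm.antidiagonal 3).over L))))))
    (fun w => (hS w).comp ((continuous_archToAdelic (↥(maximalRealSubfield L)) L (IsCMField.complexConj L) 3 ((StdForm.antidiagonal 3).over L)).comp hκc)) (fun k => hU _) hτc hτu v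

end Stable

/-! ## §2 HEADS, PROJECTOR-FREE AND MEASURE-FREE: `hW1` from (hFIN) and (hISO) «the τ-isotypic vectors of the τ-level atoms lie in the τ-block» -/

section Isotypic

variable (L : Type) [Field L] [NumberField L] [IsCMField L]
  (μ : Measure (quasiSplit (↥(maximalRealSubfield L)) L (IsCMField.complexConj L) 3).automorphicQuotient)
  [(quasiSplit (↥(maximalRealSubfield L)) L (IsCMField.complexConj L) 3).IsAutomorphicMeasure μ]
  (ξ : OneDimAutRepH L) (μω : HeckeCharacter L)

/-- **EVERY τ-LEVEL ATOM LIES IN THE τ-BLOCK, FROM (hISO)** «for every irreducible unitary finite-dimensional `τ` of `K_∞`, `resGMidAtom ξ μω (ι_f U₀) 1 ⊓ Iso_τ(R ∘ ι_∞|_{K_∞}) ≤ resGMidBlockτ ξ μω`»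
(NO measure, NO projector in the letter): for `v` in the atom every `K_∞`-type cut `P_τ v` lies in `atom ⊓ Iso_τ` (§1), hence in the τ-block, and ★ p865018's Peter–Weyl separation
concludes — the Haar probability measure of the compact `K_∞` being CONSTRUCTED here (Borel σ-algebra, Mathlib `haarMeasure ⊤`). [cite: BrockerTomDieck1985, III Thm (5.10)]
[cite: MoeglinWaldspurger1995, II.1, V.3.13] -/
theorem resGMidAtom_tauLevel_le_resGMidBlockτ_of_isotypic
    {U₀ : Subgroup ↥(finAdelic (↥(maximalRealSubfield L)) L (IsCMField.complexConj L) 3 ((StdForm.antidiagonal 3).over L))}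
    (hISO : ∀ (E : Type) [NormedAddCommGroup E] [InnerProductSpace ℂ E] [FiniteDimensional ℂ E]
      (τ : ContRepresentation ℂ ↥(UnitaryGroup.arch (↥(maximalRealSubfield L)) L (IsCMField.complexConj L) 3 ((StdForm.antidiagonal 3).over L) ⊓ unitaryGroupOfForm (conjMixed (↥(maximalRealSubfield L)) L (IsCMField.complexConj L)) 1) E)
      (_ : Continuous (τ : ↥(UnitaryGroup.arch (↥(maximalRealSubfield L)) L (IsCMField.complexConj L) 3 ((StdForm.antidiagonal 3).over L) ⊓ unitaryGroupOfForm (conjMixed (↥(maximalRealSubfield L)) L (IsCMField.complexConj L)) 1) → E →L[ℂ] E))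
      (_ : τ.toRepresentation.IsIrreducible)
      (_ : ∀ (g : ↥(UnitaryGroup.arch (↥(maximalRealSubfield L)) L (IsCMField.complexConj L) 3 ((StdForm.antidiagonal 3).over L) ⊓ unitaryGroupOfForm (conjMixed (↥(maximalRealSubfield L)) L (IsCMField.complexConj L)) 1)) (x y : E), ⟪τ g x, τ g y⟫_ℂ = ⟪x, y⟫_ℂ),
      resGMidAtom L μ ξ μω (tauLevel L U₀) 1 ⊓
        ((((quasiSplit (↥(maximalRealSubfield L)) L (IsCMField.complexConj L) 3).rightRegular μ).restrict
          ((archToAdelic (↥(maximalRealSubfield L)) L (IsCMField.complexConj L) 3 ((StdForm.antidiagonal 3).over L)).comp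
            (Subgroup.inclusion (inf_le_left : (UnitaryGroup.arch (↥(maximalRealSubfield L)) L (IsCMField.complexConj L) 3 ((StdForm.antidiagonal 3).over L) ⊓ unitaryGroupOfForm (conjMixed (↥(maximalRealSubfield L)) L (IsCMField.complexConj L)) 1) ≤
              UnitaryGroup.arch (↥(maximalRealSubfield L)) L (IsCMField.complexConj L) 3 ((StdForm.antidiagonal 3).over L))))).isotypicComponent τ).toSubmodule ≤
        (resGMidBlockτ L μ ξ μω).toSubmodule) :
    resGMidAtom L μ ξ μω (tauLevel L U₀) 1 ≤ (resGMidBlockτ L μ ξ μω).toSubmodule := by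
  -- Borel σ-algebra and Haar probability measure on the compact group `K_∞`
  letI : MeasurableSpace ↥(UnitaryGroup.arch (↥(maximalRealSubfield L)) L (IsCMField.complexConj L) 3 ((StdForm.antidiagonal 3).over L) ⊓ unitaryGroupOfForm (conjMixed (↥(maximalRealSubfield L)) L (IsCMField.complexConj L)) 1) := borel _
  haveI : BorelSpace ↥(UnitaryGroup.arch (↥(maximalRealSubfield L)) L (IsCMField.complexConj L) 3 ((StdForm.antidiagonal 3).over L) ⊓ unitaryGroupOfForm (conjMixed (↥(maximalRealSubfield L)) L (IsCMField.complexConj L)) 1) := ⟨rfl⟩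
  haveI : CompactSpace ↥(UnitaryGroup.arch (↥(maximalRealSubfield L)) L (IsCMField.complexConj L) 3 ((StdForm.antidiagonal 3).over L) ⊓ unitaryGroupOfForm (conjMixed (↥(maximalRealSubfield L)) L (IsCMField.complexConj L)) 1) :=
    compactSpace_arch_inf_unitaryOne L 3 ((StdForm.antidiagonal 3).over L)
  haveI : IsProbabilityMeasure (Measure.haarMeasure (⊤ : TopologicalSpace.PositiveCompacts ↥(UnitaryGroup.arch (↥(maximalRealSubfield L)) L (IsCMField.complexConj L) 3 ((StdForm.antidiagonal 3).over L) ⊓ unitaryGroupOfForm (conjMixed (↥(maximalRealSubfield L)) L (IsCMField.complexConj L)) 1))) :=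
    ⟨by rw [← TopologicalSpace.PositiveCompacts.coe_top]; exact Measure.haarMeasure_self⟩
  intro v hv
  refine mem_closedSubrep_of_forall_kTypeProj_mem L μ (Measure.haarMeasure ⊤) (resGMidBlockτ L μ ξ μω) v fun E _ _ _ τ hτc hirr hτu => ?_
  haveI : τ.toRepresentation.IsIrreducible := hirr
  exact hISO E τ hτc hirr hτu (charProj_mem_resGMidAtom_tauLevel_inf_isotypicComponent L μ ξ μω (Measure.haarMeasure ⊤) U₀ τ hτc hτu hv)

/-- **HEAD (MEASURE-FREE LETTERS) — `hW1` OF (R)′ ∕ (M) ∕ (V♭) FROM (hFIN) AND (hISO)**: `resGMidBlock L μ ξ μω ≤ resGMidBlockτ L μ ξ μω` from the finite-adelic smoothing letter (hFIN) «the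
level-free atom lies in the closure of the τ-LEVEL atoms» (K2E1-p14 (g5) `hFIN_of_levelIdempotents`) and the ISOTYPIC letter (hISO) «for every τ-level `U₀` and every irreducible unitary
finite-dimensional `τ` of `K_∞`, the τ-isotypic vectors of `resGMidAtom ξ μω (ι_f U₀) 1` lie in the τ-block» — neither letter mentions a Haar measure, a σ-algebra or a projector, so the
(R)′ ∕ (V♭) frames bind them with NO extra structure.  (hISO) ⟸ ★ p865018's (hstab) road ∕ §3's (hKreg) + (hKwild).  Bind: ★ `res_midBlock_le_residual_of_tauAdmissible (hW1 :=
hW1_of_isotypic L μ ξ μω hFIN hISO) …`, ★ p864870 ∕ p865014 `(hW1 := …)`. [cite: MoeglinWaldspurger1995, I.2.17, II.1, V.3.13] [cite: BrockerTomDieck1985, III Thm (5.10)] [cite: Rogawski1990, §13.9 p. 229 (ii)] -/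
theorem hW1_of_isotypic
    (hFIN : resGMidAtom L μ ξ μω ⊥ 1 ≤
      (⨆ (U₀ : Subgroup ↥(finAdelic (↥(maximalRealSubfield L)) L (IsCMField.complexConj L) 3 ((StdForm.antidiagonal 3).over L))) (_ : IsTauLevel L U₀),
        resGMidAtom L μ ξ μω (tauLevel L U₀) 1).topologicalClosure)
    (hISO : ∀ (U₀ : Subgroup ↥(finAdelic (↥(maximalRealSubfield L)) L (IsCMField.complexConj L) 3 ((StdForm.antidiagonal 3).over L))) (_ : IsTauLevel L U₀)
      (E : Type) [NormedAddCommGroup E] [InnerProductSpace ℂ E] [FiniteDimensional ℂ E]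
      (τ : ContRepresentation ℂ ↥(UnitaryGroup.arch (↥(maximalRealSubfield L)) L (IsCMField.complexConj L) 3 ((StdForm.antidiagonal 3).over L) ⊓ unitaryGroupOfForm (conjMixed (↥(maximalRealSubfield L)) L (IsCMField.complexConj L)) 1) E)
      (_ : Continuous (τ : ↥(UnitaryGroup.arch (↥(maximalRealSubfield L)) L (IsCMField.complexConj L) 3 ((StdForm.antidiagonal 3).over L) ⊓ unitaryGroupOfForm (conjMixed (↥(maximalRealSubfield L)) L (IsCMField.complexConj L)) 1) → E →L[ℂ] E))
      (_ : τ.toRepresentation.IsIrreducible)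
      (_ : ∀ (g : ↥(UnitaryGroup.arch (↥(maximalRealSubfield L)) L (IsCMField.complexConj L) 3 ((StdForm.antidiagonal 3).over L) ⊓ unitaryGroupOfForm (conjMixed (↥(maximalRealSubfield L)) L (IsCMField.complexConj L)) 1)) (x y : E), ⟪τ g x, τ g y⟫_ℂ = ⟪x, y⟫_ℂ),
      resGMidAtom L μ ξ μω (tauLevel L U₀) 1 ⊓
        ((((quasiSplit (↥(maximalRealSubfield L)) L (IsCMField.complexConj L) 3).rightRegular μ).restrict
          ((archToAdelic (↥(maximalRealSubfield L)) L (IsCMField.complexConj L) 3 ((StdForm.antidiagonal 3).over L)).comp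
            (Subgroup.inclusion (inf_le_left : (UnitaryGroup.arch (↥(maximalRealSubfield L)) L (IsCMField.complexConj L) 3 ((StdForm.antidiagonal 3).over L) ⊓ unitaryGroupOfForm (conjMixed (↥(maximalRealSubfield L)) L (IsCMField.complexConj L)) 1) ≤
              UnitaryGroup.arch (↥(maximalRealSubfield L)) L (IsCMField.complexConj L) 3 ((StdForm.antidiagonal 3).over L))))).isotypicComponent τ).toSubmodule ≤
        (resGMidBlockτ L μ ξ μω).toSubmodule) :
    resGMidBlock L μ ξ μω ≤ resGMidBlockτ L μ ξ μω :=
  hW1_of_tauLevel_atoms_le L μ ξ μω hFIN fun U₀ hU₀ => resGMidAtom_tauLevel_le_resGMidBlockτ_of_isotypic L μ ξ μω fun E _ _ _ τ hτc hirr hτu => hISO U₀ hU₀ E τ hτc hirr hτu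

end Isotypic

/-! ## §3 HEADS, REGULAR ∕ WILD SPLIT (J-S8-W1′: hW1 = hW1_reg + hW1_wild): `hW1` from (hFIN), (hKwild) and the datum-level letter (hKreg) that ★ `admissible_rightAverage` concludes -/

section Regular

variable (L : Type) [Field L] [NumberField L] [IsCMField L]
  (μ : Measure (quasiSplit (↥(maximalRealSubfield L)) L (IsCMField.complexConj L) 3).automorphicQuotient)
  [(quasiSplit (↥(maximalRealSubfield L)) L (IsCMField.complexConj L) 3).IsAutomorphicMeasure μ]
  (ξ : OneDimAutRepH L) (μω : HeckeCharacter L)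
  [MeasurableSpace ↥(UnitaryGroup.arch (↥(maximalRealSubfield L)) L (IsCMField.complexConj L) 3 ((StdForm.antidiagonal 3).over L) ⊓ unitaryGroupOfForm (conjMixed (↥(maximalRealSubfield L)) L (IsCMField.complexConj L)) 1)]
  [BorelSpace ↥(UnitaryGroup.arch (↥(maximalRealSubfield L)) L (IsCMField.complexConj L) 3 ((StdForm.antidiagonal 3).over L) ⊓ unitaryGroupOfForm (conjMixed (↥(maximalRealSubfield L)) L (IsCMField.complexConj L)) 1)]
  (μK : Measure ↥(UnitaryGroup.arch (↥(maximalRealSubfield L)) L (IsCMField.complexConj L) 3 ((StdForm.antidiagonal 3).over L) ⊓ unitaryGroupOfForm (conjMixed (↥(maximalRealSubfield L)) L (IsCMField.complexConj L)) 1))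
  [IsProbabilityMeasure μK] [μK.IsMulLeftInvariant]

/-- **THE CLASSES OF REGULAR τ-LEVEL DATA LIE IN THE τ-BLOCK, FROM (hKreg)**.  A REGULAR datum at the τ-level `U₀` is ★ D1's `(φ, Ec, Sp, Fp)` (`φ ∈ V(ξ.bcη⁻¹·ξ.bcψ⁻¹·μω, ξ.ψ; ι_f U₀, 1)`
continuous; `Sp` finite real in `(1, 2]`; `Ec` holomorphic on `{1 < Re} ∖ Sp` pointwise in `g` and `= E(flat(φ, ·))` on `{2 < Re}`; pole letter `(Fp, hFp, hFpE)` at `3∕2`) WITH ESTATE T's two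
regularity exports `hE4 : ∀ z ∈ {1<Re}∖Sp, Continuous (Ec z)`, `hEbd` (joint local bound on compacta) in ★ `admissible_rightAverage`'s bytes, and `f` its class (`f =ᵐ x ↦ Fp((out x)⁻¹)(3∕2)`).
(hKreg): «for every such datum and every irreducible unitary finite-dimensional `τ` of `K_∞`, the `K_∞`-type cut `Schur.charProj μK τ (R ∘ ι_∞|_{K_∞}) f` is a τ-admissible generator
`∈ resGMidAtomGenτ ξ μω U₀`» — ★ `admissible_rightAverage` (LH4-p10 (g9), at `c := dim τ · conj χ_τ`, `ι := ι_∞ ∘ incl`, `hcomm` ★ `commute_archToAdelic_finAdelicToAdelic`, `hH` height invariance)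
+ its class bridge and `IsArchFinite` (LH4 FILE 2) conclude it BY NAME.  Then §2b of ★ p865018 puts `f` in the τ-block. [cite: MoeglinWaldspurger1995, II.1, IV.1.9–IV.1.11, V.3.13]
[cite: BrockerTomDieck1985, III Thm (5.10)] -/
theorem genRegular_tauLevel_subset_resGMidBlockτ
    (hKreg : ∀ (U₀ : Subgroup ↥(finAdelic (↥(maximalRealSubfield L)) L (IsCMField.complexConj L) 3 ((StdForm.antidiagonal 3).over L))) (_ : IsTauLevel L U₀)
      (φ : (quasiSplit (↥(maximalRealSubfield L)) L (IsCMField.complexConj L) 3).Adelic → ℂ)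
      (_ : φ ∈ chiSectionSpacePair (ξ.bcη⁻¹ * ξ.bcψ⁻¹ * μω) ξ.ψ (tauLevel L U₀) ((1 : ↥(tauLevel L U₀) →* ℂ) : ↥(tauLevel L U₀) → ℂ)) (_ : Continuous φ)
      (Ec : ℂ → (quasiSplit (↥(maximalRealSubfield L)) L (IsCMField.complexConj L) 3).Adelic → ℂ) (Sp : Finset ℂ)
      (_ : ∀ s ∈ Sp, s.im = 0 ∧ 1 < s.re ∧ s.re ≤ 2)
      (_ : ∀ g, DifferentiableOn ℂ (fun z => Ec z g) ({z : ℂ | 1 < z.re} \ (↑Sp : Set ℂ)))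
      (_ : ∀ z ∈ ({z : ℂ | 1 < z.re} \ (↑Sp : Set ℂ)), Continuous (Ec z))
      (_ : ∀ z₁ ∈ ({z : ℂ | 1 < z.re} \ (↑Sp : Set ℂ)), ∀ S : Set (quasiSplit (↥(maximalRealSubfield L)) L (IsCMField.complexConj L) 3).Adelic, IsCompact S → ∃ V ∈ 𝓝 z₁, ∃ M : ℝ, ∀ z ∈ V, ∀ g ∈ S, ‖Ec z g‖ ≤ M)
      (_ : ∀ z : ℂ, 2 < z.re → Ec z = eisensteinSeriesU (flatSectionU φ z))
      (Fp : (quasiSplit (↥(maximalRealSubfield L)) L (IsCMField.complexConj L) 3).Adelic → ℂ → ℂ)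
      (_ : ∀ g, AnalyticAt ℂ (Fp g) ((3 : ℂ) / 2))
      (_ : ∀ g, Fp g =ᶠ[𝓝[≠] ((3 : ℂ) / 2)] fun z => (z - (3 : ℂ) / 2) * Ec z g)
      (f : (quasiSplit (↥(maximalRealSubfield L)) L (IsCMField.complexConj L) 3).L2 μ)
      (_ : (f : (quasiSplit (↥(maximalRealSubfield L)) L (IsCMField.complexConj L) 3).automorphicQuotient → ℂ) =ᵐ[μ]
        fun x => Fp (Quotient.out (x : (quasiSplit (↥(maximalRealSubfield L)) L (IsCMField.complexConj L) 3).Adelic ⧸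
          (quasiSplit (↥(maximalRealSubfield L)) L (IsCMField.complexConj L) 3).quotientSubgroup))⁻¹ ((3 : ℂ) / 2))
      (E : Type) [NormedAddCommGroup E] [InnerProductSpace ℂ E] [FiniteDimensional ℂ E]
      (τ : ContRepresentation ℂ ↥(UnitaryGroup.arch (↥(maximalRealSubfield L)) L (IsCMField.complexConj L) 3 ((StdForm.antidiagonal 3).over L) ⊓ unitaryGroupOfForm (conjMixed (↥(maximalRealSubfield L)) L (IsCMField.complexConj L)) 1) E)
      (_ : Continuous (τ : ↥(UnitaryGroup.arch (↥(maximalRealSubfield L)) L (IsCMField.complexConj L) 3 ((StdForm.antidiagonal 3).over L) ⊓ unitaryGroupOfForm (conjMixed (↥(maximalRealSubfield L)) L (IsCMField.complexConj L)) 1) → E →L[ℂ] E))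
      (_ : τ.toRepresentation.IsIrreducible)
      (_ : ∀ (g : ↥(UnitaryGroup.arch (↥(maximalRealSubfield L)) L (IsCMField.complexConj L) 3 ((StdForm.antidiagonal 3).over L) ⊓ unitaryGroupOfForm (conjMixed (↥(maximalRealSubfield L)) L (IsCMField.complexConj L)) 1)) (x y : E), ⟪τ g x, τ g y⟫_ℂ = ⟪x, y⟫_ℂ),
      Schur.charProj μK τ ((((quasiSplit (↥(maximalRealSubfield L)) L (IsCMField.complexConj L) 3).rightRegular μ).restrict
        ((archToAdelic (↥(maximalRealSubfield L)) L (IsCMField.complexConj L) 3 ((StdForm.antidiagonal 3).over L)).comp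
          (Subgroup.inclusion (inf_le_left : (UnitaryGroup.arch (↥(maximalRealSubfield L)) L (IsCMField.complexConj L) 3 ((StdForm.antidiagonal 3).over L) ⊓ unitaryGroupOfForm (conjMixed (↥(maximalRealSubfield L)) L (IsCMField.complexConj L)) 1) ≤
            UnitaryGroup.arch (↥(maximalRealSubfield L)) L (IsCMField.complexConj L) 3 ((StdForm.antidiagonal 3).over L)))))) f ∈ resGMidAtomGenτ L μ ξ μω U₀)
    {U₀ : Subgroup ↥(finAdelic (↥(maximalRealSubfield L)) L (IsCMField.complexConj L) 3 ((StdForm.antidiagonal 3).over L))} (hU₀ : IsTauLevel L U₀) :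
    {f : (quasiSplit (↥(maximalRealSubfield L)) L (IsCMField.complexConj L) 3).L2 μ |
      ∃ (φ : (quasiSplit (↥(maximalRealSubfield L)) L (IsCMField.complexConj L) 3).Adelic → ℂ)
        (_ : φ ∈ chiSectionSpacePair (ξ.bcη⁻¹ * ξ.bcψ⁻¹ * μω) ξ.ψ (tauLevel L U₀) ((1 : ↥(tauLevel L U₀) →* ℂ) : ↥(tauLevel L U₀) → ℂ)) (_ : Continuous φ)
        (Ec : ℂ → (quasiSplit (↥(maximalRealSubfield L)) L (IsCMField.complexConj L) 3).Adelic → ℂ) (Sp : Finset ℂ)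
        (_ : ∀ s ∈ Sp, s.im = 0 ∧ 1 < s.re ∧ s.re ≤ 2)
        (_ : ∀ g, DifferentiableOn ℂ (fun z => Ec z g) ({z : ℂ | 1 < z.re} \ (↑Sp : Set ℂ)))
        (_ : ∀ z ∈ ({z : ℂ | 1 < z.re} \ (↑Sp : Set ℂ)), Continuous (Ec z))
        (_ : ∀ z₁ ∈ ({z : ℂ | 1 < z.re} \ (↑Sp : Set ℂ)), ∀ S : Set (quasiSplit (↥(maximalRealSubfield L)) L (IsCMField.complexConj L) 3).Adelic, IsCompact S → ∃ V ∈ 𝓝 z₁, ∃ M : ℝ, ∀ z ∈ V, ∀ g ∈ S, ‖Ec z g‖ ≤ M)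
        (_ : ∀ z : ℂ, 2 < z.re → Ec z = eisensteinSeriesU (flatSectionU φ z))
        (Fp : (quasiSplit (↥(maximalRealSubfield L)) L (IsCMField.complexConj L) 3).Adelic → ℂ → ℂ)
        (_ : ∀ g, AnalyticAt ℂ (Fp g) ((3 : ℂ) / 2))
        (_ : ∀ g, Fp g =ᶠ[𝓝[≠] ((3 : ℂ) / 2)] fun z => (z - (3 : ℂ) / 2) * Ec z g),
        (f : (quasiSplit (↥(maximalRealSubfield L)) L (IsCMField.complexConj L) 3).automorphicQuotient → ℂ) =ᵐ[μ]
          fun x => Fp (Quotient.out (x : (quasiSplit (↥(maximalRealSubfield L)) L (IsCMField.complexConj L) 3).Adelic ⧸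
            (quasiSplit (↥(maximalRealSubfield L)) L (IsCMField.complexConj L) 3).quotientSubgroup))⁻¹ ((3 : ℂ) / 2)} ⊆
      ((resGMidBlockτ L μ ξ μω).toSubmodule : Set ((quasiSplit (↥(maximalRealSubfield L)) L (IsCMField.complexConj L) 3).L2 μ)) := by
  rintro f ⟨φ, hφV, hφc, Ec, Sp, hSp, hol, hE4, hEbd, hEc2, Fp, hFp, hFpE, hae⟩
  exact mem_closedSubrep_of_forall_kTypeProj_mem L μ μK (resGMidBlockτ L μ ξ μω) f fun E _ _ _ τ hτc hirr hτu =>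
    mem_resGMidBlockτ_of_mem_gen L μ ξ μω hU₀ (hKreg U₀ hU₀ φ hφV hφc Ec Sp hSp hol hE4 hEbd hEc2 Fp hFp hFpE f hae E τ hτc hirr hτu)

/-- **HEAD (REGULAR ∕ WILD SPLIT, J-S8-W1′) — `hW1` OF (R)′ ∕ (M) ∕ (V♭) FROM (hFIN), (hKwild) AND (hKreg)**: `resGMidBlock L μ ξ μω ≤ resGMidBlockτ L μ ξ μω`.  (hFIN) = finite-adelic smoothing
(K2E1-p14 (g5)); (hKreg) = `K_∞`-type cuts of the classes of REGULAR τ-level data are τ-admissible generators (★ `admissible_rightAverage` + LH4-p10 (g9)'s FILE 2, by name); (hKwild) =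
hW1_wild «every τ-level atom is the closed span of the classes of its REGULAR data» — i.e. the residue classes of τ-level data whose continuation `Ec` is merely pointwise-holomorphic in `g`
(no continuity, no local bound) are `L²`-limits of regular ones: L, UNOWNED, unprinted as typed (honest).  Proof: §3's regular classes lie in the τ-block, which is closed; (hKwild); ★
`hW1_of_tauLevel_atoms_le`. [cite: MoeglinWaldspurger1995, I.2.17, II.1, IV.1.11, V.3.13] [cite: BrockerTomDieck1985, III Thm (5.10)] [cite: Rogawski1990, §13.9 p. 229 (ii)] -/
theorem hW1_of_regular
    (hFIN : resGMidAtom L μ ξ μω ⊥ 1 ≤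
      (⨆ (U₀ : Subgroup ↥(finAdelic (↥(maximalRealSubfield L)) L (IsCMField.complexConj L) 3 ((StdForm.antidiagonal 3).over L))) (_ : IsTauLevel L U₀),
        resGMidAtom L μ ξ μω (tauLevel L U₀) 1).topologicalClosure)
    (hKwild : ∀ (U₀ : Subgroup ↥(finAdelic (↥(maximalRealSubfield L)) L (IsCMField.complexConj L) 3 ((StdForm.antidiagonal 3).over L))) (_ : IsTauLevel L U₀),
      resGMidAtom L μ ξ μω (tauLevel L U₀) 1 ≤
        (Submodule.span ℂ {f : (quasiSplit (↥(maximalRealSubfield L)) L (IsCMField.complexConj L) 3).L2 μ |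
          ∃ (φ : (quasiSplit (↥(maximalRealSubfield L)) L (IsCMField.complexConj L) 3).Adelic → ℂ)
            (_ : φ ∈ chiSectionSpacePair (ξ.bcη⁻¹ * ξ.bcψ⁻¹ * μω) ξ.ψ (tauLevel L U₀) ((1 : ↥(tauLevel L U₀) →* ℂ) : ↥(tauLevel L U₀) → ℂ)) (_ : Continuous φ)
            (Ec : ℂ → (quasiSplit (↥(maximalRealSubfield L)) L (IsCMField.complexConj L) 3).Adelic → ℂ) (Sp : Finset ℂ)
            (_ : ∀ s ∈ Sp, s.im = 0 ∧ 1 < s.re ∧ s.re ≤ 2)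
            (_ : ∀ g, DifferentiableOn ℂ (fun z => Ec z g) ({z : ℂ | 1 < z.re} \ (↑Sp : Set ℂ)))
            (_ : ∀ z ∈ ({z : ℂ | 1 < z.re} \ (↑Sp : Set ℂ)), Continuous (Ec z))
            (_ : ∀ z₁ ∈ ({z : ℂ | 1 < z.re} \ (↑Sp : Set ℂ)), ∀ S : Set (quasiSplit (↥(maximalRealSubfield L)) L (IsCMField.complexConj L) 3).Adelic, IsCompact S → ∃ V ∈ 𝓝 z₁, ∃ M : ℝ, ∀ z ∈ V, ∀ g ∈ S, ‖Ec z g‖ ≤ M)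
            (_ : ∀ z : ℂ, 2 < z.re → Ec z = eisensteinSeriesU (flatSectionU φ z))
            (Fp : (quasiSplit (↥(maximalRealSubfield L)) L (IsCMField.complexConj L) 3).Adelic → ℂ → ℂ)
            (_ : ∀ g, AnalyticAt ℂ (Fp g) ((3 : ℂ) / 2))
            (_ : ∀ g, Fp g =ᶠ[𝓝[≠] ((3 : ℂ) / 2)] fun z => (z - (3 : ℂ) / 2) * Ec z g),
            (f : (quasiSplit (↥(maximalRealSubfield L)) L (IsCMField.complexConj L) 3).automorphicQuotient → ℂ) =ᵐ[μ]
              fun x => Fp (Quotient.out (x : (quasiSplit (↥(maximalRealSubfield L)) L (IsCMField.complexConj L) 3).Adelic ⧸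
                (quasiSplit (↥(maximalRealSubfield L)) L (IsCMField.complexConj L) 3).quotientSubgroup))⁻¹ ((3 : ℂ) / 2)}).topologicalClosure)
    (hKreg : ∀ (U₀ : Subgroup ↥(finAdelic (↥(maximalRealSubfield L)) L (IsCMField.complexConj L) 3 ((StdForm.antidiagonal 3).over L))) (_ : IsTauLevel L U₀)
      (φ : (quasiSplit (↥(maximalRealSubfield L)) L (IsCMField.complexConj L) 3).Adelic → ℂ)
      (_ : φ ∈ chiSectionSpacePair (ξ.bcη⁻¹ * ξ.bcψ⁻¹ * μω) ξ.ψ (tauLevel L U₀) ((1 : ↥(tauLevel L U₀) →* ℂ) : ↥(tauLevel L U₀) → ℂ)) (_ : Continuous φ)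
      (Ec : ℂ → (quasiSplit (↥(maximalRealSubfield L)) L (IsCMField.complexConj L) 3).Adelic → ℂ) (Sp : Finset ℂ)
      (_ : ∀ s ∈ Sp, s.im = 0 ∧ 1 < s.re ∧ s.re ≤ 2)
      (_ : ∀ g, DifferentiableOn ℂ (fun z => Ec z g) ({z : ℂ | 1 < z.re} \ (↑Sp : Set ℂ)))
      (_ : ∀ z ∈ ({z : ℂ | 1 < z.re} \ (↑Sp : Set ℂ)), Continuous (Ec z))
      (_ : ∀ z₁ ∈ ({z : ℂ | 1 < z.re} \ (↑Sp : Set ℂ)), ∀ S : Set (quasiSplit (↥(maximalRealSubfield L)) L (IsCMField.complexConj L) 3).Adelic, IsCompact S → ∃ V ∈ 𝓝 z₁, ∃ M : ℝ, ∀ z ∈ V, ∀ g ∈ S, ‖Ec z g‖ ≤ M)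
      (_ : ∀ z : ℂ, 2 < z.re → Ec z = eisensteinSeriesU (flatSectionU φ z))
      (Fp : (quasiSplit (↥(maximalRealSubfield L)) L (IsCMField.complexConj L) 3).Adelic → ℂ → ℂ)
      (_ : ∀ g, AnalyticAt ℂ (Fp g) ((3 : ℂ) / 2))
      (_ : ∀ g, Fp g =ᶠ[𝓝[≠] ((3 : ℂ) / 2)] fun z => (z - (3 : ℂ) / 2) * Ec z g)
      (f : (quasiSplit (↥(maximalRealSubfield L)) L (IsCMField.complexConj L) 3).L2 μ)
      (_ : (f : (quasiSplit (↥(maximalRealSubfield L)) L (IsCMField.complexConj L) 3).automorphicQuotient → ℂ) =ᵐ[μ]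
        fun x => Fp (Quotient.out (x : (quasiSplit (↥(maximalRealSubfield L)) L (IsCMField.complexConj L) 3).Adelic ⧸
          (quasiSplit (↥(maximalRealSubfield L)) L (IsCMField.complexConj L) 3).quotientSubgroup))⁻¹ ((3 : ℂ) / 2))
      (E : Type) [NormedAddCommGroup E] [InnerProductSpace ℂ E] [FiniteDimensional ℂ E]
      (τ : ContRepresentation ℂ ↥(UnitaryGroup.arch (↥(maximalRealSubfield L)) L (IsCMField.complexConj L) 3 ((StdForm.antidiagonal 3).over L) ⊓ unitaryGroupOfForm (conjMixed (↥(maximalRealSubfield L)) L (IsCMField.complexConj L)) 1) E)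
      (_ : Continuous (τ : ↥(UnitaryGroup.arch (↥(maximalRealSubfield L)) L (IsCMField.complexConj L) 3 ((StdForm.antidiagonal 3).over L) ⊓ unitaryGroupOfForm (conjMixed (↥(maximalRealSubfield L)) L (IsCMField.complexConj L)) 1) → E →L[ℂ] E))
      (_ : τ.toRepresentation.IsIrreducible)
      (_ : ∀ (g : ↥(UnitaryGroup.arch (↥(maximalRealSubfield L)) L (IsCMField.complexConj L) 3 ((StdForm.antidiagonal 3).over L) ⊓ unitaryGroupOfForm (conjMixed (↥(maximalRealSubfield L)) L (IsCMField.complexConj L)) 1)) (x y : E), ⟪τ g x, τ g y⟫_ℂ = ⟪x, y⟫_ℂ),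
      Schur.charProj μK τ ((((quasiSplit (↥(maximalRealSubfield L)) L (IsCMField.complexConj L) 3).rightRegular μ).restrict
        ((archToAdelic (↥(maximalRealSubfield L)) L (IsCMField.complexConj L) 3 ((StdForm.antidiagonal 3).over L)).comp
          (Subgroup.inclusion (inf_le_left : (UnitaryGroup.arch (↥(maximalRealSubfield L)) L (IsCMField.complexConj L) 3 ((StdForm.antidiagonal 3).over L) ⊓ unitaryGroupOfForm (conjMixed (↥(maximalRealSubfield L)) L (IsCMField.complexConj L)) 1) ≤
            UnitaryGroup.arch (↥(maximalRealSubfield L)) L (IsCMField.complexConj L) 3 ((StdForm.antidiagonal 3).over L)))))) f ∈ resGMidAtomGenτ L μ ξ μω U₀) :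
    resGMidBlock L μ ξ μω ≤ resGMidBlockτ L μ ξ μω :=
  hW1_of_tauLevel_atoms_le L μ ξ μω hFIN fun U₀ hU₀ =>
    (hKwild U₀ hU₀).trans (Submodule.topologicalClosure_minimal _ (Submodule.span_le.2 (genRegular_tauLevel_subset_resGMidBlockτ L μ ξ μω μK hKreg hU₀)) (resGMidBlockτ L μ ξ μω).isClosed)

end Regular

end Summit.HodgeConjecture.HodgeConjecture.R90.S8

end
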